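import Mathlib
import Literature.AlgebraicGeometry.Morphisms.CechH1Localization
import HarnessLib

/-!
# Local-to-global vanishing of Čech `Ȟ¹(𝒰, 𝒪)` over an affine base, and surjectivity of the
# pullback on `Ȟ¹` along a morphism inducing isomorphisms on sections

Two fact-free tools for the W4.4 support programme «P_G LERAY» (res-D-pv-045, PG-LERAY-NOTE blocks
(L3)/(K3)), both cochain-level:

* `cechZ1_le_cechB1_of_forall_maximal` — for an `A`-scheme `f : X → Spec A` and a finite family `𝒰` of
  affine opens with affine pairwise and triple intersections: if for every maximal ideal `𝔪 ⊆ A` the Čech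
  `H¹` of the base change `X ×_A Spec A_𝔪` (w.r.t. the pulled-back family) vanishes, then
  `Ȟ¹(𝒰, 𝒪_X) = 0`.  (By `CechH1Localization`: the pullback on `Ȟ¹` is a localisation at `𝔪`, so every
  class is killed by an element outside every maximal ideal.)  This is «`(R¹f_*𝒪)_𝔪 = 0 ∀𝔪 ⇒ R¹ = 0`»
  without `R¹`.
* `cechComapH1_surjective_of_appLE_bijective` — for a morphism `g : Y → X` of `A`-schemes whose section
  maps `Γ(X, U_i ∩ U_j) → Γ(Y, g⁻¹U_i ∩ g⁻¹U_j)` are bijective and `Γ(X, U_i ∩ U_j ∩ U_k) → Γ(Y, …)`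
  injective (e.g. `g` proper birational onto a normal `X`, `g_*𝒪_Y = 𝒪_X`), the pullback
  `Ȟ¹(𝒰, 𝒪_X) → Ȟ¹(g⁻¹𝒰, 𝒪_Y)` is surjective — the easy edge of the Leray sequence,
  `H¹(X, g_*𝒪_Y) ↠ (indeed =) Ȟ¹(g⁻¹𝒰, 𝒪_Y)`.

Mathlib searched (pin v4.32): `Ideal.exists_le_maximal`, `IsLocalizedModule.eq_zero_iff` (used); no Čech
cohomology of schemes in Mathlib.

## References
* A. Grothendieck, J. Dieudonné, EGA III₁, Prop. (1.4.15), Cor. (1.4.17). [EGAIII1]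
* The Stacks Project, Tag 02KH, Tag 01ED. [StacksProject]
-/

noncomputable section

open CategoryTheory AlgebraicGeometry Limits TopologicalSpace Opposite

universe u v

namespace Literature.AlgebraicGeometry.Morphisms

namespace CechLocalization

/-! ## Local-to-global vanishing -/

section LocalGlobal

variable {A : Type u} [CommRing A] {X : Scheme.{u}} (f : X ⟶ Spec (.of A))
  {ι : Type v} [Finite ι] (U : ι → X.Opens)

/-- **`Ȟ¹(𝒰, 𝒪_X) = 0` if it vanishes after base change to every `Spec A_𝔪`** (`𝔪` maximal):
for a finite family of affine opens with affine pairwise and triple intersections.  The base change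
is Mathlib's chosen `pullback f (Spec A_𝔪 → Spec A)` with its projections.
[cite: EGAIII1, Prop. (1.4.15)] -/
theorem cechZ1_le_cechB1_of_forall_maximal (hU : ∀ i, IsAffineOpen (U i))
    (hU2 : ∀ i j, IsAffineOpen (U i ⊓ U j)) (hU3 : ∀ i j k, IsAffineOpen (U i ⊓ U j ⊓ U k))
    (h : ∀ (𝔪 : Ideal A) [𝔪.IsMaximal],
      cechZ1 (pullback.snd f (Spec.map (CommRingCat.ofHom
          (algebraMap A (Localization.AtPrime 𝔪)))) ≫
        Spec.map (CommRingCat.ofHom (algebraMap A (Localization.AtPrime 𝔪))))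
        (preimageFamily (pullback.fst f (Spec.map (CommRingCat.ofHom
          (algebraMap A (Localization.AtPrime 𝔪))))) U) ≤
      cechB1 (pullback.snd f (Spec.map (CommRingCat.ofHom
          (algebraMap A (Localization.AtPrime 𝔪)))) ≫
        Spec.map (CommRingCat.ofHom (algebraMap A (Localization.AtPrime 𝔪))))
        (preimageFamily (pullback.fst f (Spec.map (CommRingCat.ofHom
          (algebraMap A (Localization.AtPrime 𝔪))))) U)) :
    cechZ1 f U ≤ cechB1 f U := by
  intro z hz
  -- the class of `z`, and the ideal of scalars killing it
  set c : CechH1 f U := CechH1.mk f U ⟨z, hz⟩ with hc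
  suffices hc0 : c = 0 by
    exact (CechH1.mk_eq_zero_iff f U ⟨z, hz⟩).mp hc0
  -- every maximal ideal misses some scalar killing `c`
  have hkill : ∀ (𝔪 : Ideal A) [𝔪.IsMaximal], ∃ s : A, s ∉ 𝔪 ∧ s • c = 0 := by
    intro 𝔪 _
    set φ := CommRingCat.ofHom (algebraMap A (Localization.AtPrime 𝔪)) with hφ
    haveI hloc := isLocalizedModule_cechComapH1 𝔪.primeCompl f (pullback.snd f (Spec.map φ))
      (pullback.snd f (Spec.map φ) ≫ Spec.map φ) (pullback.fst f (Spec.map φ)) rfl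
      (IsPullback.of_hasPullback f (Spec.map φ)) U hU hU2 hU3
    have himg : cechComapH1 f (pullback.snd f (Spec.map φ) ≫ Spec.map φ) (pullback.fst f (Spec.map φ))
        (IsPullback.of_hasPullback f (Spec.map φ)).w U c = 0 := by
      rw [hc, cechComapH1_mk, CechH1.mk_eq_zero_iff, cechComapZ1_coe]
      exact h 𝔪 (comapC1_mem_cechZ1 f _ _ _ U hz)
    obtain ⟨s, hs⟩ := (IsLocalizedModule.eq_zero_iff 𝔪.primeCompl
      (cechComapH1 f (pullback.snd f (Spec.map φ) ≫ Spec.map φ) (pullback.fst f (Spec.map φ))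
        (IsPullback.of_hasPullback f (Spec.map φ)).w U)).mp himg
    exact ⟨s, s.2, hs⟩
  -- hence the annihilator of `c` is the unit ideal
  by_contra hne
  let I : Ideal A := (LinearMap.toSpanSingleton A (CechH1 f U) c).ker
  have hI : I ≠ ⊤ := by
    intro hI
    have h1 : (1 : A) ∈ I := hI ▸ Submodule.mem_top
    have : (1 : A) • c = 0 := h1
    exact hne (by simpa using this)
  obtain ⟨𝔪, h𝔪, hI𝔪⟩ := Ideal.exists_le_maximal I hI
  obtain ⟨s, hs𝔪, hsc⟩ := hkill 𝔪
  exact hs𝔪 (hI𝔪 (show s ∈ I from hsc))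

end LocalGlobal

/-! ## Surjectivity of the pullback along section isomorphisms -/

section Surjective

variable {A : Type u} [CommRing A] {X Y : Scheme.{u}} (fX : X ⟶ Spec (.of A))
  (fY : Y ⟶ Spec (.of A)) (g : Y ⟶ X) (hg : g ≫ fX = fY) {ι : Type v} (U : ι → X.Opens)

/-- **The pullback `Ȟ¹(𝒰, 𝒪_X) → Ȟ¹(g⁻¹𝒰, 𝒪_Y)` is surjective** when the section maps of `g` are
bijective on the pairwise intersections `U_i ∩ U_j` and injective on the triple intersections (lift a
cocycle of `Y` componentwise; the cocycle identity is checked after the injective map on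
`g⁻¹U_i ∩ g⁻¹U_j ∩ g⁻¹U_k`). [cite: StacksProject, Tag 01ED] -/
theorem cechComapH1_surjective_of_appLE_bijective
    (h2 : ∀ i j, Function.Bijective (Sections.comap fX fY g hg
      (show g ⁻¹ᵁ U i ⊓ g ⁻¹ᵁ U j ≤ g ⁻¹ᵁ (U i ⊓ U j) from fun _ hx => hx)))
    (h3 : ∀ i j k, Function.Injective (Sections.comap fX fY g hg
      (show g ⁻¹ᵁ U i ⊓ g ⁻¹ᵁ U j ⊓ g ⁻¹ᵁ U k ≤ g ⁻¹ᵁ (U i ⊓ U j ⊓ U k) from fun _ hx => hx))) :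
    Function.Surjective (cechComapH1 fX fY g hg U) := by
  intro x
  obtain ⟨⟨c', hc'⟩, rfl⟩ := CechH1.mk_surjective fY (preimageFamily g U) x
  -- lift the cochain componentwise
  choose c hc using fun i j => (h2 i j).2 (c' i j)
  have hcomap : cechComapC1 fX fY g hg U c = c' := by
    ext i j
    exact hc i j
  -- the lift is a cocycle: check after the injective map on triple intersections
  have hcZ : c ∈ cechZ1 fX U := by
    rw [mem_cechZ1_iff]
    ext i j k
    apply h3 i j k
    have e := congrFun (congrFun (congrFun (cechD1_comapC1 fX fY g hg U c) i) j) k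
    rw [hcomap, (mem_cechZ1_iff fY _ c').mp hc'] at e
    rw [cechComapC2_apply] at e
    exact e.symm.trans (by simp only [Pi.zero_apply, map_zero])
  refine ⟨CechH1.mk fX U ⟨c, hcZ⟩, ?_⟩
  rw [cechComapH1_mk]
  congr 1
  exact Subtype.ext hcomap

end Surjective

end CechLocalization

end Literature.AlgebraicGeometry.Morphisms

end
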